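import Mathlib
import HarnessLib
import Literature.Analysis.FluidPDE.SwirlTransportProofs
import Literature.Analysis.FluidPDE.AxisymVorticityAlgebra
import Summits.NavierStokesRegularity.NavierStokesRegularity.Theorems.HalfSpaceWindowDoorCirculationCarryingRigidityEddyTorqueLiouville
import Summits.NavierStokesRegularity.NavierStokesRegularity.Theorems.HalfSpaceWindowDoorCirculationCarryingRigidityEddyTorqueOneSided
import Summits.NavierStokesRegularity.NavierStokesRegularity.Theorems.HalfSpaceWindowDoorCirculationCarryingRigiditySubSwirlLiouville
import Summits.NavierStokesRegularity.NavierStokesRegularity.Theorems.PoloidalWindowDoorPoloidalWindowRigidityClassSpaceTimeRates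

/-!
# Route `HalfSpaceWindowDoor`, crux `CirculationCarryingRigidity` (stmt-NavierStokesRegularity-25311) — census theorem
# `eddy_torque` II: closed-hemisphere axis-Type-I profiles whose eddies never SPIN UP the mean vortex faster than
# `A/(r+√(−s))·∮ω₃` are POLOIDAL (the ONE-SIDED eddy-torque Liouville theorem)

Line `eddy_torque` (LEAD ns-hsw-p1 g5; the «next engine» of g4's blueprint, crux card `Lines/eddy_torque.md`).  THEOREM
(`inner_curl_e3_eq_zero_of_axisTypeI_remainder_le_oneSided`, unconditional): a profile of the door's Type-I ancient Oseen-mild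
class with (i) the AXIS-Type-I bound `‖v(t,x)‖ ≤ D/(|x_h| + √(−t))`, (ii) the sign `⟪curl v, e₃⟫ ≥ 0`, and (iii) the ONE-SIDED
eddy-torque condition on the fluctuation remainder of the circle-averaged swirl law (AxisTwistDoor `…Defs.remainder`; minus the
net torque of the non-axisymmetric modes on the axis circle),

  `ℛ(r,z,s) ≤ A/(r + √(−s)) · ∮_{S(r,z)} ω₃ dl`   for all `r > 0`, `z`, `s < 0`   — NO lower bound —

is POLOIDAL: `⟪curl v, e₃⟫ ≡ 0` on the slab.  The landed two-sided theorem (`…EddyTorqueLiouville`, `|ℛ| ≤ …`) is the special case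
`−A/(r+√(−s))·∮ω₃ ≤ ℛ ≤ A/(r+√(−s))·∮ω₃`; the corollary `…_of_remainder_nonpos` (`A = 0`: eddies only spin the mean vortex DOWN,
down-gradient angular-momentum transport of any size) is new.  PROOF: `F = (2π)⁻¹Γ` with the angular-mean drift `⟨v⟩_θ` is a
swirl SUBSOLUTION pair (`isSubSwirl_circF_oneSided`: the two differential inequalities are g4's brick 0
`…EddyTorqueOneSided.circF_subsolution_of_oneSided` with `A' = A` and `A' = A r/√(−s)`; the gradient bound
`‖∇F‖ ≤ max(C,K)(1/√(−s) + r/(−s))` from `DΓ̄[h] = (2π)⁻¹∮(⟪Jx, Dv h⟫ + ⟪Jh, v⟫)` and the class rates `‖v‖ ≤ C/√(−s)`,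
`‖∇v‖ ≤ K/(−s)`; joint smoothness of `⟨v⟩_θ` by differentiation under the angular integral); the swirl subsolution Liouville
theorem (`…SubSwirlLiouville.eq_zero_of_nonneg`, KNSS 2009 Thm 5.3 for subsolutions, plateau by positivity propagation)
gives `Γ ≡ 0`, whence `∮ω₃ dl ≡ 0`, `ω₃ = 0` on `{y₁ > 0}` and everywhere by unique continuation — g4's tail verbatim.

CENSUS MEANING (25311).  Sharpens the residue of the stub `HemisphereLiouvilleE3` in the axis-Type-I (and space–time Type-I) subclass to:
«closed-hemisphere profiles whose eddy angular-momentum flux divergence SPINS UP the mean vortex on some axis circles faster than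
`A/(r+√(−s))·∮ω₃`»; spin-down of any size is harmless.  Door statements concern HYPOTHETICAL blow-up profiles.

Seat ns-hsw-p1 g5 (LEAD of 25311, cell pub-ns-dss).  WHAT THIS IS NOT: not a statement about Navier–Stokes regularity
(Clay A): a Liouville-type theorem about hypothetical blow-up profiles; the crux, its stub and NS regularity remain OPEN;
helper `--supports` 25311.
-/

noncomputable section

-- the summit and its single sub-problem share the name (CONVENTIONS §1), as in every Theorems file
set_option linter.dupNamespace false

namespace Summit.NavierStokesRegularity.NavierStokesRegularity.Theorems.HalfSpaceWindowDoorCirculationCarryingRigidityEddyTorqueOneSidedLiouville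

open MeasureTheory Set Function Filter Topology TopologicalSpace InnerProductSpace WithLp Metric
open scoped Laplacian RealInnerProductSpace ContDiff Classical
open Literature.Analysis Literature.Analysis.FluidPDE
open Summit.NavierStokesRegularity.NavierStokesRegularity.Theorems.HalfSpaceWindowDoorCirculationCarryingRigidityDefs (IsSubSwirl)
open Summit.NavierStokesRegularity.NavierStokesRegularity.Theorems.AxisTwistDoorAveragedConeLiouvilleDefs
  (cylPt eT e3 circ vortCirc radVortCirc tiltCirc circleTerm meanR meanZ remainder SignE3)
open Summit.NavierStokesRegularity.NavierStokesRegularity.Theorems.AveragedConeLiouville.CircleStokes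
  (deriv_circ_eq_vortCirc inner_e3)
open Summit.NavierStokesRegularity.NavierStokesRegularity.Theorems.AveragedConeLiouville.CircMonotone
  (circ_zero vortCirc_zero vortCirc_nonneg circ_nonneg)
open Summit.NavierStokesRegularity.NavierStokesRegularity.Theorems.AveragedConeLiouville.FlatFlux
  (eq_zero_of_integral_eq_zero_of_nonneg exists_cylPt_eq)
open Summit.NavierStokesRegularity.NavierStokesRegularity.Theorems.AveragedConeLiouville.ShellBookkeeping (cylRadius_cylPt)
open Summit.NavierStokesRegularity.NavierStokesRegularity.Theorems.AxisTwistDoorAveragedConeLiouvilleCylFrame (continuous_cylPt_θ)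
open Summit.NavierStokesRegularity.NavierStokesRegularity.Theorems.HalfSpaceWindowDoorCirculationCarryingRigidityAxisCirculation
open Summit.NavierStokesRegularity.NavierStokesRegularity.Theorems.HalfSpaceWindowDoorCirculationCarryingRigidityAxisTypeILiouville
  (axisBound_nonneg abs_circF_le_of_axisBound axisBound_of_hasTypeIDecay)
open Summit.NavierStokesRegularity.NavierStokesRegularity.Theorems.HalfSpaceWindowDoorCirculationCarryingRigidityHemisphereSupport
  (inner_curl_e3_eq_zero_of_open)
open Summit.NavierStokesRegularity.NavierStokesRegularity.Theorems.HalfSpaceWindowDoorCirculationCarryingRigidityAngularMeanDrift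
open Summit.NavierStokesRegularity.NavierStokesRegularity.Theorems.HalfSpaceWindowDoorCirculationCarryingRigidityEddyTorqueOneSided
  (horizontal_eq_smul_eR circF_subsolution_of_oneSided)
open Summit.NavierStokesRegularity.NavierStokesRegularity.Theorems.HalfSpaceWindowDoorCirculationCarryingRigiditySubSwirlLiouville
open Summit.NavierStokesRegularity.NavierStokesRegularity.Theorems.PoloidalWindowDoorPoloidalWindowRigidityClassSpaceTimeRates
  (exists_fderiv_rate_of_class')

variable {C D A : ℝ} {v : ℝ → EuclideanSpace ℝ (Fin 3) → EuclideanSpace ℝ (Fin 3)}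

/-! ### The gradient of the lifted circulation -/

/-- **`|DΓ̄(x)[h]| ≤ (r(x)·‖Du‖_∞ + ‖u‖_∞)‖h‖` for the swirl**: `D(swirl u)(x)[h] = ⟪Jx, Du(x)h⟫ + ⟪Jh, u(x)⟫`, `‖Jx‖ = r(x)`,
`‖Jh‖ ≤ ‖h‖`. -/
theorem norm_fderiv_swirl_apply_le {u : EuclideanSpace ℝ (Fin 3) → EuclideanSpace ℝ (Fin 3)} (hu : ContDiff ℝ 1 u)
    (x h : EuclideanSpace ℝ (Fin 3)) :
    ‖fderiv ℝ (swirl u) x h‖ ≤ (cylRadius x * ‖fderiv ℝ u x‖ + ‖u x‖) * ‖h‖ := by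
  have hd : DifferentiableAt ℝ u x := (hu.differentiable (by simp)).differentiableAt
  rw [fderiv_swirl_apply hd h]
  have hJx : ‖rotGen x‖ = cylRadius x := by rw [norm_rotGen]; rfl
  have hJh : ‖rotGen h‖ ≤ ‖h‖ := by
    rw [norm_rotGen, EuclideanSpace.norm_eq, Fin.sum_univ_three]
    refine Real.sqrt_le_sqrt ?_
    simp only [Real.norm_eq_abs, sq_abs]
    nlinarith [sq_nonneg (h 2)]
  refine (norm_add_le _ _).trans ?_
  have h1 : ‖⟪rotGen x, fderiv ℝ u x h⟫_ℝ‖ ≤ cylRadius x * ‖fderiv ℝ u x‖ * ‖h‖ := by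
    refine (norm_inner_le_norm _ _).trans ?_
    rw [hJx, mul_assoc]
    exact mul_le_mul_of_nonneg_left ((fderiv ℝ u x).le_opNorm h) (cylRadius_nonneg x)
  have h2 : ‖⟪rotGen h, u x⟫_ℝ‖ ≤ ‖u x‖ * ‖h‖ := by
    refine (norm_inner_le_norm _ _).trans ?_
    rw [mul_comm]
    exact mul_le_mul_of_nonneg_left hJh (norm_nonneg _)
  linarith

/-- **The gradient of the angular mean of the swirl**: if `‖u‖ ≤ a` and `‖Du‖ ≤ b` everywhere, then
`‖D⟨swirl u⟩_θ(y)‖ ≤ a + b·r(y)` (differentiation under the angular integral, `r(R_θ y) = r(y)`, `‖R_θ h‖ = ‖h‖`). -/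
theorem norm_fderiv_angularMean_swirl_le {u : EuclideanSpace ℝ (Fin 3) → EuclideanSpace ℝ (Fin 3)} (hu : ContDiff ℝ 1 u)
    {a b : ℝ} (ha : ∀ x, ‖u x‖ ≤ a) (hb : ∀ x, ‖fderiv ℝ u x‖ ≤ b) (y : EuclideanSpace ℝ (Fin 3)) :
    ‖fderiv ℝ (angularMean (swirl u)) y‖ ≤ a + b * cylRadius y := by
  have ha0 : 0 ≤ a := (norm_nonneg _).trans (ha 0)
  have hb0 : 0 ≤ b := (norm_nonneg _).trans (hb 0)
  have hB : 0 ≤ a + b * cylRadius y := by have := cylRadius_nonneg y; positivity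
  have hsw : ContDiff ℝ 1 (swirl u) := contDiff_swirl' hu
  refine ContinuousLinearMap.opNorm_le_bound _ hB fun h => ?_
  rw [fderiv_angularMean_apply hsw, norm_smul, norm_inv, Real.norm_of_nonneg (by positivity)]
  have hI : ‖∫ θ in (0 : ℝ)..2 * Real.pi, fderiv ℝ (swirl u) (rotZ θ y) (rotZ θ h)‖ ≤
      (a + b * cylRadius y) * ‖h‖ * |2 * Real.pi - 0| := by
    refine intervalIntegral.norm_integral_le_of_norm_le_const fun θ _ => ?_
    calc ‖fderiv ℝ (swirl u) (rotZ θ y) (rotZ θ h)‖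
        ≤ (cylRadius (rotZ θ y) * ‖fderiv ℝ u (rotZ θ y)‖ + ‖u (rotZ θ y)‖) * ‖rotZ θ h‖ :=
          norm_fderiv_swirl_apply_le hu _ _
      _ ≤ (cylRadius y * b + a) * ‖h‖ := by
          rw [cylRadius_rotZ, norm_rotZ]
          exact mul_le_mul_of_nonneg_right (add_le_add (mul_le_mul_of_nonneg_left (hb _) (cylRadius_nonneg y)) (ha _))
            (norm_nonneg _)
      _ = (a + b * cylRadius y) * ‖h‖ := by ring
  rw [sub_zero, abs_of_pos (by positivity : (0 : ℝ) < 2 * Real.pi)] at hI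
  calc (2 * Real.pi)⁻¹ * ‖∫ θ in (0 : ℝ)..2 * Real.pi, fderiv ℝ (swirl u) (rotZ θ y) (rotZ θ h)‖
      ≤ (2 * Real.pi)⁻¹ * ((a + b * cylRadius y) * ‖h‖ * (2 * Real.pi)) := mul_le_mul_of_nonneg_left hI (by positivity)
    _ = (a + b * cylRadius y) * ‖h‖ := by field_simp

/-- **The scale-invariant gradient bound of the lifted circulation** for a door-class profile: with the Type-I rate `C` and the
class gradient rate `K`, `‖∇F(s,x)‖ ≤ max(C,K)·(1/√(−s) + r/(−s))`, `F = (2π)⁻¹Γ = ⟨swirl v(s)⟩_θ`. -/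
theorem exists_grad_bound_circF (hrate : HasTypeITimeDecay C v)
    (hcont : ContinuousOn (uncurry v) (Iio (0 : ℝ) ×ˢ univ))
    (hmild : ∀ s t : ℝ, s < t → t < 0 → ∀ x,
      v t x = UnboundedOperators.heatExtension (v s) (t - s) x - oseenDuhamel 1 s v v t x)
    (hdiv : ∀ t < 0, VectorCalculus.IsDivFree (v t)) :
    ∃ Cg : ℝ, ∀ s < 0, ∀ x : EuclideanSpace ℝ (Fin 3),
      ‖fderiv ℝ (fun y : EuclideanSpace ℝ (Fin 3) => (2 * Real.pi)⁻¹ * circ v (cylRadius y) (y 2) s) x‖ ≤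
        Cg * (1 / Real.sqrt (0 - s) + cylRadius x / (0 - s)) := by
  have hsm : IsSmoothSpaceTimeOn (Iio (0 : ℝ)) v := isSmoothSpaceTimeOn_of_class hrate hcont hmild hdiv
  obtain ⟨K, hK0, hK⟩ := exists_fderiv_rate_of_class' hrate hcont hmild
  refine ⟨max C K, fun s hs x => ?_⟩
  have hv1 : ContDiff ℝ 1 (v s) := (hsm.contDiff_slice hs).of_le (by norm_cast)
  have hspos : 0 < -s := by linarith
  have hsq : 0 < Real.sqrt (-s) := Real.sqrt_pos.2 hspos
  rw [circF_eq_angularMean v s, zero_sub]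
  have h := norm_fderiv_angularMean_swirl_le hv1 (a := C / Real.sqrt (-s)) (b := K / (-s))
    (fun y => hrate s hs y) (fun y => hK s hs y) x
  refine h.trans ?_
  have hC : C ≤ max C K := le_max_left _ _
  have hK' : K ≤ max C K := le_max_right _ _
  have hr := cylRadius_nonneg x
  have e1 : K / (-s) * cylRadius x = K * cylRadius x / (-s) := by ring
  have e2 : max C K * (1 / Real.sqrt (-s) + cylRadius x / (-s)) = max C K / Real.sqrt (-s) + max C K * cylRadius x / (-s) := by
    ring
  rw [e1, e2]
  exact add_le_add (div_le_div_of_nonneg_right hC hsq.le)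
    (div_le_div_of_nonneg_right (mul_le_mul_of_nonneg_right hK' hr) hspos.le)

/-! ### Joint smoothness of the angular-mean drift -/

/-- The angular mean of the velocity, `(s,x) ↦ ⟨v(s)⟩_θ(x)`, is jointly smooth on the open slab (differentiation under
`∫₀^{2π}` of the jointly smooth integrand `R_{−θ} v(s, R_θ x)`). -/
theorem isSmoothSpaceTimeOn_angularMeanVec (hsm : IsSmoothSpaceTimeOn (Iio (0 : ℝ)) v) :
    IsSmoothSpaceTimeOn (Iio (0 : ℝ)) (fun s (x : EuclideanSpace ℝ (Fin 3)) => angularMeanVec (v s) x) := by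
  set H : ℝ × (ℝ × EuclideanSpace ℝ (Fin 3)) → EuclideanSpace ℝ (Fin 3) :=
    fun w => rotZ (-w.1) (v w.2.1 (rotZ w.1 w.2.2)) with hH
  have hrot : ContDiff ℝ ∞ fun w : ℝ × (ℝ × EuclideanSpace ℝ (Fin 3)) => rotZ w.1 w.2.2 :=
    contDiff_rotZ_uncurry.comp₂ contDiff_fst (contDiff_snd.comp contDiff_snd)
  have h21 : ContDiff ℝ ∞ fun w : ℝ × (ℝ × EuclideanSpace ℝ (Fin 3)) => w.2.1 := contDiff_fst.comp contDiff_snd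
  have hg : ContDiff ℝ ∞ fun w : ℝ × (ℝ × EuclideanSpace ℝ (Fin 3)) =>
      ((w.2.1, rotZ w.1 w.2.2) : ℝ × EuclideanSpace ℝ (Fin 3)) := h21.prodMk hrot
  have hmaps : MapsTo (fun w : ℝ × (ℝ × EuclideanSpace ℝ (Fin 3)) =>
      ((w.2.1, rotZ w.1 w.2.2) : ℝ × EuclideanSpace ℝ (Fin 3))) (univ ×ˢ (Iio (0 : ℝ) ×ˢ univ))
      (Iio (0 : ℝ) ×ˢ univ) := by
    intro w hw
    simp only [mem_prod, mem_univ, mem_Iio, true_and, and_true] at hw ⊢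
    exact hw
  have hvw : ContDiffOn ℝ ∞ (fun w : ℝ × (ℝ × EuclideanSpace ℝ (Fin 3)) => v w.2.1 (rotZ w.1 w.2.2))
      (univ ×ˢ (Iio (0 : ℝ) ×ˢ univ)) := hsm.comp hg.contDiffOn hmaps
  have hHs : ContDiffOn ℝ ∞ H (univ ×ˢ (Iio (0 : ℝ) ×ˢ univ)) := by
    have hneg : ContDiff ℝ ∞ fun w : ℝ × (ℝ × EuclideanSpace ℝ (Fin 3)) => -w.1 := contDiff_fst.neg
    exact contDiff_rotZ_uncurry.comp₂_contDiffOn hneg.contDiffOn hvw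
  have hI := contDiffOn_parametric_intervalIntegral_prod (convex_Iio (0 : ℝ))
    (by rw [interior_Iio]; exact ⟨-1, by norm_num⟩) hHs 0 (2 * Real.pi)
  have hI' := hI.const_smul ((2 * Real.pi)⁻¹ : ℝ)
  refine hI'.congr fun p _ => ?_
  show angularMeanVec (v p.1) p.2 = (2 * Real.pi)⁻¹ • ∫ θ in (0:ℝ)..(2 * Real.pi), H (θ, p)
  rw [angularMeanVec_apply]

/-! ### The swirl subsolution pair of a one-sided profile -/

/-- **`(F, ⟨v⟩_θ)` is a swirl SUBSOLUTION pair** with `C_f = C_u = D`, source constant `A`, `τ = 0`, for a door-class profile under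
the axis-Type-I bound, the closed-hemisphere sign and the ONE-SIDED eddy bound `ℛ ≤ A/(r+√(−s))·∮ω₃ dl` off the axis. -/
theorem exists_isSubSwirl_circF_oneSided (hrate : HasTypeITimeDecay C v)
    (hcont : ContinuousOn (uncurry v) (Iio (0 : ℝ) ×ˢ univ))
    (hmild : ∀ s t : ℝ, s < t → t < 0 → ∀ x,
      v t x = UnboundedOperators.heatExtension (v s) (t - s) x - oseenDuhamel 1 s v v t x)
    (hdiv : ∀ t < 0, VectorCalculus.IsDivFree (v t))
    (hDax : ∀ t < 0, ∀ x : EuclideanSpace ℝ (Fin 3), ‖v t x‖ ≤ D / (cylRadius x + Real.sqrt (-t)))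
    (hsign : SignE3 v) (hA : 0 ≤ A)
    (hrem : ∀ s < 0, ∀ x : EuclideanSpace ℝ (Fin 3), cylRadius x ≠ 0 →
      remainder v (cylRadius x) (x 2) s ≤ A / (cylRadius x + Real.sqrt (-s)) * vortCirc v (cylRadius x) (x 2) s) :
    ∃ Cg : ℝ, IsSubSwirl D D Cg A 0
      (fun s (x : EuclideanSpace ℝ (Fin 3)) => (2 * Real.pi)⁻¹ * circ v (cylRadius x) (x 2) s)
      (fun (s : ℝ) (x : EuclideanSpace ℝ (Fin 3)) => if s < 0 then angularMeanVec (v s) x else 0) := by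
  have hsm : IsSmoothSpaceTimeOn (Iio (0 : ℝ)) v := isSmoothSpaceTimeOn_of_class hrate hcont hmild hdiv
  have hSF := isSmoothSpaceTimeOn_circF hsm
  obtain ⟨Cg, hCg⟩ := exists_grad_bound_circF hrate hcont hmild hdiv
  refine ⟨Cg, ?_, hSF, ?_, ?_, ?_, ?_, ?_, ?_, hCg, measurable_meanDrift hcont, ?_, ?_, ?_, ?_, hA, ?_, ?_⟩
  · intro t ht; exact contDiff_circF (hsm.contDiff_slice ht)
  · exact hSF.continuousOn_fderiv_slice (uniqueDiffOn_Iio 0)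
  · exact (hSF.laplacian (uniqueDiffOn_Iio 0)).continuousOn
  · intro t _; exact isAxisymmetricScalar_circF v t
  · intro t _ x hx; exact circF_axis v t hx
  · intro t ht x; exact abs_circF_le_of_axisBound hDax ht x
  · intro t ht x; exact fderiv_circF_eR_nonneg hsm hsign ht x
  · intro t ht
    have e : (fun (x : EuclideanSpace ℝ (Fin 3)) => if t < 0 then angularMeanVec (v t) x else 0) =
        angularMeanVec (v t) := by funext x; simp only [if_pos ht]
    show ContDiff ℝ (⊤ : ℕ∞) (fun (x : EuclideanSpace ℝ (Fin 3)) => if t < 0 then angularMeanVec (v t) x else 0)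
    rw [e]; exact contDiff_angularMeanVec_slice hsm ht
  · -- joint smoothness of the drift on the slab
    refine (isSmoothSpaceTimeOn_angularMeanVec hsm).congr fun p hp => ?_
    have hp1 : p.1 < 0 := hp.1
    simp only [uncurry, if_pos hp1]
  · intro t ht
    have e : (fun (x : EuclideanSpace ℝ (Fin 3)) => if t < 0 then angularMeanVec (v t) x else 0) =
        angularMeanVec (v t) := by funext x; simp only [if_pos ht]
    show VectorCalculus.IsDivFree (fun (x : EuclideanSpace ℝ (Fin 3)) => if t < 0 then angularMeanVec (v t) x else 0)
    rw [e]; exact isDivFree_angularMeanVec hsm hdiv ht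
  · intro t ht x
    simp only [if_pos ht]
    exact cylRadius_mul_norm_angularMeanVec_le hDax ht x
  · -- the radial form: brick 0 with `A' = A`
    intro t ht x hx
    have hr : 0 < cylRadius x := lt_of_le_of_ne (cylRadius_nonneg x) (Ne.symm hx)
    have hsq : 0 < Real.sqrt (-t) := Real.sqrt_pos.2 (by linarith)
    have hW : 0 ≤ vortCirc v (cylRadius x) (x 2) t := vortCirc_nonneg v hsign ht (cylRadius_nonneg x) _
    have heddy : remainder v (cylRadius x) (x 2) t ≤ A / cylRadius x * vortCirc v (cylRadius x) (x 2) t := by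
      refine (hrem t ht x hx).trans (mul_le_mul_of_nonneg_right ?_ hW)
      exact div_le_div_of_nonneg_left hA hr (by linarith [hsq.le])
    have h := circF_subsolution_of_oneSided hrate hcont hmild hdiv ht hx heddy
    have hdiffF : DifferentiableAt ℝ (fun y : EuclideanSpace ℝ (Fin 3) => (2 * Real.pi)⁻¹ * circ v (cylRadius y) (y 2) t) x :=
      ((contDiff_circF (hsm.contDiff_slice ht)).differentiable (by simp)).differentiableAt
    rw [map_add, map_smul, horizontal_eq_smul_eR hx, map_smul, smul_eq_mul, smul_eq_mul] at h
    simp only [if_pos ht, partialDeriv_apply]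
    have e : (2 - A) / cylRadius x ^ 2 * (cylRadius x *
        fderiv ℝ (fun y : EuclideanSpace ℝ (Fin 3) => (2 * Real.pi)⁻¹ * circ v (cylRadius y) (y 2) t) x (eR x)) =
        2 / cylRadius x * fderiv ℝ (fun y : EuclideanSpace ℝ (Fin 3) => (2 * Real.pi)⁻¹ * circ v (cylRadius y) (y 2) t) x (eR x) -
        A / cylRadius x * fderiv ℝ (fun y : EuclideanSpace ℝ (Fin 3) => (2 * Real.pi)⁻¹ * circ v (cylRadius y) (y 2) t) x (eR x) := by
      field_simp
    rw [e] at h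
    linarith
  · -- the time form: brick 0 with `A' = A r/√(−t)`
    intro t ht x hx
    have hr : 0 < cylRadius x := lt_of_le_of_ne (cylRadius_nonneg x) (Ne.symm hx)
    have hsq : 0 < Real.sqrt (-t) := Real.sqrt_pos.2 (by linarith)
    have hW : 0 ≤ vortCirc v (cylRadius x) (x 2) t := vortCirc_nonneg v hsign ht (cylRadius_nonneg x) _
    have heddy : remainder v (cylRadius x) (x 2) t ≤
        (A * cylRadius x / Real.sqrt (-t)) / cylRadius x * vortCirc v (cylRadius x) (x 2) t := by
      refine (hrem t ht x hx).trans (mul_le_mul_of_nonneg_right ?_ hW)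
      rw [show A * cylRadius x / Real.sqrt (-t) / cylRadius x = A / Real.sqrt (-t) by field_simp]
      exact div_le_div_of_nonneg_left hA hsq (by linarith [hr.le])
    have h := circF_subsolution_of_oneSided hrate hcont hmild hdiv ht hx heddy
    rw [map_add, map_smul, horizontal_eq_smul_eR hx, map_smul, smul_eq_mul, smul_eq_mul] at h
    simp only [if_pos ht, partialDeriv_apply, zero_sub]
    have e : (2 - A * cylRadius x / Real.sqrt (-t)) / cylRadius x ^ 2 * (cylRadius x *
        fderiv ℝ (fun y : EuclideanSpace ℝ (Fin 3) => (2 * Real.pi)⁻¹ * circ v (cylRadius y) (y 2) t) x (eR x)) =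
        2 / cylRadius x * fderiv ℝ (fun y : EuclideanSpace ℝ (Fin 3) => (2 * Real.pi)⁻¹ * circ v (cylRadius y) (y 2) t) x (eR x) -
        A / Real.sqrt (-t) *
          fderiv ℝ (fun y : EuclideanSpace ℝ (Fin 3) => (2 * Real.pi)⁻¹ * circ v (cylRadius y) (y 2) t) x (eR x) := by
      field_simp
    rw [e] at h
    linarith

/-! ### The one-sided eddy-torque Liouville theorem -/

/-- From `F = (2π)⁻¹Γ ≡ 0` to poloidality (g4's tail: `∮ω₃ dl = ∂ᵣΓ ≡ 0`, `ω₃ = 0` on `{y₁ > 0}` by sign + continuity, everywhere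
by unique continuation). -/
theorem poloidal_of_circF_eq_zero (hrate : HasTypeITimeDecay C v)
    (hcont : ContinuousOn (uncurry v) (Iio (0 : ℝ) ×ˢ univ))
    (hmild : ∀ s t : ℝ, s < t → t < 0 → ∀ x,
      v t x = UnboundedOperators.heatExtension (v s) (t - s) x - oseenDuhamel 1 s v v t x)
    (hdiv : ∀ t < 0, VectorCalculus.IsDivFree (v t)) (hsign : SignE3 v)
    (hF0 : ∀ t < 0, ∀ x : EuclideanSpace ℝ (Fin 3), (2 * Real.pi)⁻¹ * circ v (cylRadius x) (x 2) t = 0) :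
    ∀ s < 0, ∀ y, ⟪curl (v s) y, (EuclideanSpace.single (2 : Fin 3) (1 : ℝ))⟫_ℝ = 0 := by
  have hsm : IsSmoothSpaceTimeOn (Iio (0 : ℝ)) v := isSmoothSpaceTimeOn_of_class hrate hcont hmild hdiv
  have hcirc : ∀ s < 0, ∀ r : ℝ, 0 ≤ r → ∀ z : ℝ, circ v r z s = 0 := by
    intro s hs r hr z
    have h := hF0 s hs (cylPt r 0 z)
    rw [cylRadius_cylPt hr] at h
    have hz : (cylPt r 0 z) 2 = z := by simp [cylPt]
    rw [hz] at h
    have hπ : (2 * Real.pi)⁻¹ ≠ 0 := by positivity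
    exact (mul_eq_zero.1 h).resolve_left hπ
  have hvort0 : ∀ s < 0, ∀ r : ℝ, 0 < r → ∀ z : ℝ, vortCirc v r z s = 0 := by
    intro s hs r hr z
    have hv1 : ContDiff ℝ 1 (v s) := (hsm.contDiff_slice hs).of_le (by norm_cast)
    have hev : (fun r' => circ v r' z s) =ᶠ[𝓝 r] fun _ => (0 : ℝ) := by
      filter_upwards [Ioi_mem_nhds hr] with r' hr'
      exact hcirc s hs r' (le_of_lt hr') z
    rw [← deriv_circ_eq_vortCirc v hv1 r z, hev.deriv_eq, deriv_const]
  set O : Set (ℝ × EuclideanSpace ℝ (Fin 3)) := Iio (0 : ℝ) ×ˢ {y | 0 < y 1} with hO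
  have hOopen : IsOpen O := isOpen_Iio.prod (isOpen_lt continuous_const (EuclideanSpace.proj (1 : Fin 3)).continuous)
  have hOne : O.Nonempty := ⟨(-1, EuclideanSpace.single (1 : Fin 3) (1 : ℝ)), mk_mem_prod (by norm_num) (by simp)⟩
  have hOsub : O ⊆ Iio (0 : ℝ) ×ˢ univ := prod_mono Subset.rfl (subset_univ _)
  have hzero : ∀ p ∈ O, ⟪curl (v p.1) p.2, HalfSpaceWindowDoorCirculationCarryingRigidityDefs.e3⟫_ℝ = 0 := by
    rintro ⟨s, y⟩ ⟨hs, hy⟩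
    have hs' : s < 0 := hs
    have hy' : 0 < y 1 := hy
    have hv1 : ContDiff ℝ 1 (v s) := (hsm.contDiff_slice hs').of_le (by norm_cast)
    obtain ⟨r, θ, hr, -, hθ, hyeq⟩ := exists_cylPt_eq hy'
    have hωc : Continuous fun θ' => ⟪curl (v s) (cylPt r θ' (y 2)), e3⟫_ℝ * r :=
      (((continuous_curl hv1).comp (continuous_cylPt_θ r (y 2))).inner continuous_const).mul continuous_const
    have hnn : ∀ θ', 0 ≤ ⟪curl (v s) (cylPt r θ' (y 2)), e3⟫_ℝ * r :=
      fun θ' => mul_nonneg (hsign s hs' _) hr.le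
    have hint : ∫ θ' in (0 : ℝ)..(2 * Real.pi), ⟪curl (v s) (cylPt r θ' (y 2)), e3⟫_ℝ * r = 0 := hvort0 s hs' r hr (y 2)
    have h := eq_zero_of_integral_eq_zero_of_nonneg hωc hnn hint hθ
    rw [hyeq] at h
    show ⟪curl (v s) y, e3⟫_ℝ = 0
    exact (mul_eq_zero.1 h).resolve_right hr.ne'
  exact inner_curl_e3_eq_zero_of_open hrate hcont hmild hOopen hOne hOsub hzero

/-- **THE ONE-SIDED EDDY-TORQUE CENSUS THEOREM.**  A profile of the door's Type-I ancient Oseen-mild class (Type-I time rate,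
continuity on the open slab, unit-viscosity Oseen–Duhamel identity, divergence-free slices) with the AXIS-Type-I bound
`‖v(t,x)‖ ≤ D/(|x_h| + √(−t))` and the closed-hemisphere sign `⟪curl v, e₃⟫ ≥ 0`, whose fluctuation remainder (eddy torque)
satisfies the ONE-SIDED bound `ℛ(r,z,s) ≤ A/(r + √(−s)) · ∮_{S(r,z)} ω₃ dl` for all `r > 0`, `z`, `s < 0` — eddy SPIN-UP slaved to the
mean vertical vorticity, spin-down free — is POLOIDAL: `⟪curl v, e₃⟫ ≡ 0` on the slab. -/
theorem inner_curl_e3_eq_zero_of_axisTypeI_remainder_le_oneSided (C D A : ℝ)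
    (v : ℝ → EuclideanSpace ℝ (Fin 3) → EuclideanSpace ℝ (Fin 3))
    (hrate : HasTypeITimeDecay C v)
    (hcont : ContinuousOn (uncurry v) (Iio (0 : ℝ) ×ˢ univ))
    (hmild : ∀ s t : ℝ, s < t → t < 0 → ∀ x,
      v t x = UnboundedOperators.heatExtension (v s) (t - s) x - oseenDuhamel 1 s v v t x)
    (hdiv : ∀ t < 0, VectorCalculus.IsDivFree (v t))
    (hDax : ∀ t < 0, ∀ x : EuclideanSpace ℝ (Fin 3), ‖v t x‖ ≤ D / (cylRadius x + Real.sqrt (-t)))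
    (hsign : ∀ s < 0, ∀ y, 0 ≤ ⟪curl (v s) y, (EuclideanSpace.single (2 : Fin 3) (1 : ℝ))⟫_ℝ)
    (hA : 0 ≤ A)
    (hrem : ∀ s < 0, ∀ r : ℝ, 0 < r → ∀ z : ℝ, remainder v r z s ≤ A / (r + Real.sqrt (-s)) * vortCirc v r z s) :
    ∀ s < 0, ∀ y, ⟪curl (v s) y, (EuclideanSpace.single (2 : Fin 3) (1 : ℝ))⟫_ℝ = 0 := by
  have hsm : IsSmoothSpaceTimeOn (Iio (0 : ℝ)) v := isSmoothSpaceTimeOn_of_class hrate hcont hmild hdiv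
  have hsign' : SignE3 v := hsign
  have hrem' : ∀ s < 0, ∀ x : EuclideanSpace ℝ (Fin 3), cylRadius x ≠ 0 →
      remainder v (cylRadius x) (x 2) s ≤ A / (cylRadius x + Real.sqrt (-s)) * vortCirc v (cylRadius x) (x 2) s :=
    fun s hs x hx => hrem s hs (cylRadius x) (lt_of_le_of_ne (cylRadius_nonneg x) (Ne.symm hx)) (x 2)
  obtain ⟨Cg, hS⟩ := exists_isSubSwirl_circF_oneSided hrate hcont hmild hdiv hDax hsign' hA hrem'
  have hFnn : ∀ t < 0, ∀ x : EuclideanSpace ℝ (Fin 3), 0 ≤ (2 * Real.pi)⁻¹ * circ v (cylRadius x) (x 2) t := by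
    intro t ht x
    have hv1 : ContDiff ℝ 1 (v t) := (hsm.contDiff_slice ht).of_le (by norm_cast)
    exact mul_nonneg (by positivity) (circ_nonneg (v := v) hv1 hsign' ht (cylRadius_nonneg x) _)
  have hF0 := IsSubSwirl.eq_zero_of_nonneg hS hFnn
  exact poloidal_of_circF_eq_zero hrate hcont hmild hdiv hsign' hF0

/-- **Corollary (space–time Type-I subclass `HasTypeIDecay D v`)**: the space–time bound implies the axis bound. -/
theorem inner_curl_e3_eq_zero_of_hasTypeIDecay_remainder_le_oneSided (C D A : ℝ)
    (v : ℝ → EuclideanSpace ℝ (Fin 3) → EuclideanSpace ℝ (Fin 3))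
    (hrate : HasTypeITimeDecay C v)
    (hcont : ContinuousOn (uncurry v) (Iio (0 : ℝ) ×ˢ univ))
    (hmild : ∀ s t : ℝ, s < t → t < 0 → ∀ x,
      v t x = UnboundedOperators.heatExtension (v s) (t - s) x - oseenDuhamel 1 s v v t x)
    (hdiv : ∀ t < 0, VectorCalculus.IsDivFree (v t)) (hD : HasTypeIDecay D v)
    (hsign : ∀ s < 0, ∀ y, 0 ≤ ⟪curl (v s) y, (EuclideanSpace.single (2 : Fin 3) (1 : ℝ))⟫_ℝ)
    (hA : 0 ≤ A)
    (hrem : ∀ s < 0, ∀ r : ℝ, 0 < r → ∀ z : ℝ, remainder v r z s ≤ A / (r + Real.sqrt (-s)) * vortCirc v r z s) :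
    ∀ s < 0, ∀ y, ⟪curl (v s) y, (EuclideanSpace.single (2 : Fin 3) (1 : ℝ))⟫_ℝ = 0 :=
  inner_curl_e3_eq_zero_of_axisTypeI_remainder_le_oneSided C D A v hrate hcont hmild hdiv (axisBound_of_hasTypeIDecay hD)
    hsign hA hrem

/-- **Corollary (SPIN-DOWN EDDIES ARE HARMLESS)**: if the eddy torque never spins the mean vortex up, `ℛ ≤ 0` on every axis circle
(down-gradient eddy angular-momentum transport of any size), a closed-hemisphere axis-Type-I profile of the class is poloidal. -/
theorem inner_curl_e3_eq_zero_of_axisTypeI_remainder_nonpos (C D : ℝ)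
    (v : ℝ → EuclideanSpace ℝ (Fin 3) → EuclideanSpace ℝ (Fin 3))
    (hrate : HasTypeITimeDecay C v)
    (hcont : ContinuousOn (uncurry v) (Iio (0 : ℝ) ×ˢ univ))
    (hmild : ∀ s t : ℝ, s < t → t < 0 → ∀ x,
      v t x = UnboundedOperators.heatExtension (v s) (t - s) x - oseenDuhamel 1 s v v t x)
    (hdiv : ∀ t < 0, VectorCalculus.IsDivFree (v t))
    (hDax : ∀ t < 0, ∀ x : EuclideanSpace ℝ (Fin 3), ‖v t x‖ ≤ D / (cylRadius x + Real.sqrt (-t)))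
    (hsign : ∀ s < 0, ∀ y, 0 ≤ ⟪curl (v s) y, (EuclideanSpace.single (2 : Fin 3) (1 : ℝ))⟫_ℝ)
    (hrem : ∀ s < 0, ∀ r : ℝ, 0 < r → ∀ z : ℝ, remainder v r z s ≤ 0) :
    ∀ s < 0, ∀ y, ⟪curl (v s) y, (EuclideanSpace.single (2 : Fin 3) (1 : ℝ))⟫_ℝ = 0 :=
  inner_curl_e3_eq_zero_of_axisTypeI_remainder_le_oneSided C D 0 v hrate hcont hmild hdiv hDax hsign le_rfl
    fun s hs r hr z => by rw [zero_div, zero_mul]; exact hrem s hs r hr z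

end Summit.NavierStokesRegularity.NavierStokesRegularity.Theorems.HalfSpaceWindowDoorCirculationCarryingRigidityEddyTorqueOneSidedLiouville

end
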